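import Mathlib
import HarnessLib
import HarnessLib.Audit
import Summits.AnomalousDissipation.Statement
import Literature.Analysis.FluidPDE.LerayHopf
import Literature.Analysis.FluidPDE.ZerothLaw
import Literature.Analysis.FluidPDE.DoeringFoias
import Summits.AnomalousDissipation.AnomalousDissipation.Theses.RootDecompCycle1C
import Summits.AnomalousDissipation.AnomalousDissipation.Theses.LoudWindows
import HarnessLib.Audit.Status.Attr

/-!
Route: DecoupledCatalysts

# Route DecoupledCatalysts — Designer extension — tied designer anomalies must leave long loud
windows at fixed viscosity (decoupled catalysts as the normal form), landing on the loud-windows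
trunk

decomp-ad RESIDUAL DECOMPOSITION, generation 8, lens-6 «barrier-complement carving», node
DecoupledCatalysts AS RE-BOOKED BY THE CRITIC (cell HOME run/shared/lean/pub/decomp-ad; node
HOME/decomp-ad-lens-6/DecoupledCatalysts.lean sha256 182b9c2f4c9bd954, `lean check` rc 0 · 0 err · 0
warn · 0 sorry, 414 lines; card DecoupledCatalysts_NODE.md b96e193a…; probes 6/6 `#h21_crux_probe`
CLEAN; critic verdict decomp-ad-crit-1 g2 STATUS 2026-08-30T07:48:49Z «CLEARED AS JUNCTION +
RE-BOOKING: the declared residual of the designer axis is W′ DesignerExtension := 24896 → 24058,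
filed with WindowCompactnessLink / PowerRealisesDissipationLink by name; D CatalystDecoupling ∧ T
DecoupledRemoval ⟹ W′ is the LINE / normal form of W′, not a split of it»; writer paste check
g4/DE/SketchDE.lean a9375958… rc 0 · 0 sorry: chk_A/chk_W/chk_K/chk_R/chk_24897 := Iff.rfl,
`closes`, `closes_via_1C`, `designerTransferJunctionGlue_holds`, `designerExtension_of_normalForm`).
CHILD ROUTE of route-AnomalousDissipation-RootDecompCycle1C refining its summit-strength DECLARED
RESIDUAL 24897 `DesignerTransfer := SteadyDesignerAnomaly → S` (already split there by g3 into
26782/26783 + 26784, so an in-place refinement would need an operator `--resplit`; the child-route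
form needs nobody's grant — critic, same utc). It suffices to show: A (24896 SteadyDesignerAnomaly,
SHARED BY SIGNATURE with 1C/InviscidWork) ∧ W′ DesignerExtension (NEW DECLARED RESIDUAL: a tied
steady designer anomaly forces, for some admissible force at viscosities ν_j → 0, lens-3's LONG LOUD
WINDOWS 24058 at every fixed ν_j) ∧ K WindowCompactnessLink (= LoudWindows 24059 by name, spelling
of DwellLadder 30104) ∧ R PowerRealisesDissipationLink (= LoudWindows 24060 by name, spelling of
DwellLadder 30105). Kernel bookkeeping (node + sketch, 0 sorry): 24897 → W′ (given S → 24058,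
lens-3's necessity theorem re-run in the node l.283–333) and W′ → K → R → 24897
(`designerTransferJunctionGlue_holds`), so 24897 ⟺ W′ modulo A-independent theorem-grade/declared
items counted ONCE in the cell (K, R live on LoudWindows); W′ is the force-side twin of
DwellLadder's 30103 HorizonExtension (26351 → 24058, time side) — two distinct OR-branch residuals
landing on the same hinge 24058 (critic (iii)).
Lean: `SteadyDesignerAnomaly → DesignerExtension → WindowCompactnessLink →
PowerRealisesDissipationLink → _root_.AnomalousDissipation`
(over Literature.Analysis.FluidPDE.Torus.IsGlobalLerayHopf,
Literature.Analysis.FluidPDE.{meanEnergy, meanDissipation, timeMean},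
Literature.Analysis.FunctionSpaces.Torus.{IsSmooth, IsDivFree, HasZeroMean}, MeasureTheory.{MemLp,
eLpNorm, volume}, Filter.Tendsto,
Summit.AnomalousDissipation.AnomalousDissipation.Theses.LoudWindows.{LongLoudWindows,
WindowCompactness, PowerRealisesDissipation, closes}, ….RootDecompCycle1C.{SteadyDesignerAnomaly,
DesignerTransfer, closes} — every constant confirmed by elaboration of SketchDE.lean and the native
route check).

Rationale: WHY THIS LINE. Axis = the QUANTIFIER ORDER of the designer catalyst c_j := fs j − f, read in
lens-3's finite-window POWER currency. The node's repair census V1–V7 of 24897 (force topology;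
amplitude ladder; spectral placement; background change of variables = g3's 26782/26783;
tied-catalyst junction; long-time power transfer = lens-3's 24059; certified negative) leaves one
live dial: TIED catalysts (one per ν_j — the class of every known fake, Cheskidov's Thm 1.3 families
arXiv:2311.04182, recorded OUTSIDE-class in
Literature/Barriers/AnomalousDissipation/ForceRobustEstimates.lean) versus what the TRUE force must
do on its own at each fixed ν_j. The critic's booking rule (D-0171 «residual = the weakest necessary
statement available») puts the residual at W′ := 24896 → 24058: kernel-necessary (S → 24058),
implied by 24897, and strictly below the node's dissipation-currency D (D ∧ T ⟹ W′ by the node's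
fixed-ν theorem T; the surplus D − W′ is Leray-toll content of the kind already booked once in R
24060). The node's mathematics survives as W′'s NORMAL FORM and attack plan: W′ ⟺ (24896 → CW
«decoupled catalyst windows») modulo theorem-grade bookkeeping both ways — ⇐ by T₂ CatalystStability
(fixed-ν weak sequential stability: admissible g_n → f in L², capped data, Aubin–Lions on 𝕋³, limit
run is Leray–Hopf after a restart at a strong-convergence time; Temam1977 Ch. III Thm 3.1,
FMRTTurbulence2001 p.333, Chepyzhov–Titi–Vishik doi:10.3934/dcds.2007.17.481 Prop. 2,
RobinsonRodrigoSadowski2016), ⇒ by capping/restart of the loud windows at g := f (a T₁-type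
Cesàro/pigeonhole lemma) — so the lever is the SSP reading «catalyst = trigger, not crutch»
(doi:10.1063/1.869185; thresholds δ_c ∼ Re^(−γ), arXiv:1403.6374) and the instrument is census
T-SHRINK read in power-window currency. Imported areas: fixed-viscosity Leray–Hopf compactness (T₂,
fileable support, THM-GRADE L cleared true) and shear-flow self-sustainment phenomenology (the
failure world W_crutch); nothing is transplanted as a theorem about ν → 0.

RANKED CRUXES. #2 DesignerExtension (crux) — W′ · DESIGNER EXTENSION = the NEW DECLARED RESIDUAL of
the designer axis (critic's re-booking; text = (24896-text) → (24058-text), both tree texts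
verbatim): IF some L² force f is the L²-limit of admissible steady forces fs j driving global
Leray–Hopf runs at viscosities ν_j → 0 with mean energy ≤ E and mean dissipation ≥ ε > 0 (a TIED
steady designer anomaly), THEN for some ADMISSIBLE force f′ and some ν′_j → 0 there are E′, β > 0,
T₀ such that at EVERY level j and for EVERY T ≥ T₀ some datum and global Leray–Hopf run of NS(ν′_j,
f′) have running means over [0, T]: energy ≤ E′ and injected f′-power ≥ β (lens-3's 24058
LongLoudWindows). KERNEL-WEAKER than 24897 (24897 → W′ needs only S → 24058, proved in the node
against tree decls); = 24897 modulo (A, K, R); force-side twin of DwellLadder 30103. NORMAL FORM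
(critic): W′ ⟺ (24896 → CW CatalystWindows: loud bounded windows of every length under admissible
forces δ-close to f′, δ → 0 allowed to depend on (L, ν_j)) modulo T₂ CatalystStability (support,
filed after birth) and a T₁-type capping lemma. Failure worlds named in the docstring: W_crutch
(every designer anomaly needs catalysts ≥ δ_c(ν_j) > 0: the carrier alone is laminar-attracting for
loud bounded data at each fixed ν) and W_rough (tied designer anomalies exist only at NON-SMOOTH
limit forces — 24896's f is merely L², 24058's force is admissible smooth; cf. the C^α-force
threshold of ForceRobustEstimates scope (d)). Tags: DECLARED RESIDUAL · KERNEL-NECESSARY ·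
UNDECIDED(T-SHRINK, power-window reading) · IDEA-NEEDED (self-sustainment at fixed Re / catalyst
continuation to zero) · BARRIER-ADJACENT. [difficulty: open-problem] (why it might fail: W_crutch:
designer anomalies may need catalysts ≥ δ_c(ν_j) > 0 with the carrier laminar-attracting at each
fixed ν (δ_c ∼ Re^(−γ), arXiv:1403.6374); W_rough: tied anomalies only at non-smooth limit forces.
Both consistent with all known theorems.) [arXiv:2311.04182, doi:10.1063/1.869185,
doi:10.1017/jfm.2017.97, arXiv:1403.6374,
run/shared/lean/pub/decomp-ad/decomp-ad-lens-6/DecoupledCatalysts_NODE.md]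
#3 SteadyDesignerAnomaly (crux) — SHARED BY SIGNATURE with route RootDecompCycle1C item 24896 (crux
2 of 1C, SPLIT there into 27505 JunctionCascadeAnomaly ∧ 27506 FrozenLift, 27505 refined by the
child route InviscidWork / BilateralWork 30039; also binder of InviscidWork; text verbatim,
untouched by this node): STEADY DESIGNER ANOMALY — some L² force f is the L²-limit of admissible
steady forces fs j driving global Leray–Hopf runs u j at viscosities ν_j → 0 with sup_j meanEnergy ≤
E and meanDissipation ≥ ε > 0 for all j. Not re-staffed here. [difficulty: open-problem] (why it
might fail: Conjunct A of the root split: a designer family needs a mechanism holding dissipation up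
as ν ↓ 0 at bounded energy with steady admissible forces; every candidate (junction cascade, frozen
lift, bilateral selection) is open and the rigid/symmetric classes are excluded by the cell's no-go
lemmas.) [arXiv:2311.04182, DoeringFoias2002, arXiv:2409.03599, arXiv:1902.08084]
#9 WindowCompactnessLink (support) — K · CROSS-LINK BY NAME to LoudWindows item 24059
WindowCompactness (`LongLoudWindows → PowerFloorFamily`; theorem-grade L, staffed on LoudWindows
only; the spelling is DwellLadder's 30104 verbatim so the item MERGES by signature — counted once in
the cell; closes by `id` the moment 24059 lands). [difficulty: L] (why it might fail: It is lens-3's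
theorem-grade compactness step (long loud windows ⇒ a power-floor family); risk = size of the
Leray–Hopf window-compactness formalisation, not truth.)
[run/shared/lean/pub/decomp-ad/decomp-ad-lens-3/LoudWindows_NODE.md, Temam1977, FMRTTurbulence2001]
#9 PowerRealisesDissipationLink (support) — R · CROSS-LINK BY NAME to LoudWindows item 24060
PowerRealisesDissipation (`PowerFloorFamily → S`; lens-3's ONE declared Leray–Hopf toll — power
floors realised as dissipation; spelling = DwellLadder's 30105 verbatim, merges by signature,
counted once; not re-split here). [difficulty: open-problem] (why it might fail: The Leray–Hopf
energy-equality obstruction (W_defect: power injected need not be dissipated along a weak solution);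
it is the cell's one declared toll, placed by lens-3, residual of LoudWindows.)
[run/shared/lean/pub/decomp-ad/decomp-ad-lens-3/LoudWindows_NODE.md, DuchonRobert2000,
arXiv:1710.05205]

TWO-LAYER PLAN. No split of W′ at birth. Filed right after birth as SUPPORTS (not cruxes, never
staffed as residuals): T₂ CatalystStability := (CW-text) → LoudWindows.LongLoudWindows (THM-GRADE L,
ATTACKABLE NOW, cleared true by the critic — fixed-ν weak sequential stability) and the junction
glue DesignerTransferJunctionGlue := DesignerExtension → WindowCompactnessLink →
PowerRealisesDissipationLink → RootDecompCycle1C.DesignerTransfer (provable now; records «refines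
24897»). If the lineage later wants the decoupled statement itself as an item, it is D_P := 24896 →
CW filed BENEATH W′ as «normal form ≡ W′ mod bookkeeping» (glue D_P → CatalystStability →
DesignerExtension, sketch `designerExtension_of_normalForm`), never as a weaker piece; the
dissipation-currency D and T₁ of the node are NOT filed (critic: over-typed / moot).

KILL CRITERIA. W′ dies (and with it this line; 24897 and 1C survive as the coarser residual) if
census T-SHRINK on a QUIET-CARRIER designer family (f alone laminar-stable at the working Re) shows,
in POWER-WINDOW currency, that after rescaling the catalyst c ↦ θc (θ ∈ {1/2, 1/4, 1/8, 0}, same ν,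
loud state as datum) the windows L ∈ {10, 30, 100} turnovers lose their f-power floor β(L) as θ ↓ 0
with loud-state lifetimes NOT increasing, reproducibly at two smaller ν — W_crutch realised; then
`route close --reason refuted:DesignerExtension` unless a certified fixed-ν self-sustainment theorem
for some admissible carrier appears. If 24060 (R) is refuted on LoudWindows, this route,
DwellLadder's top and LoudWindows die together (the toll is counted once). If 24897 is proved
directly, or 24896 refuted (InviscidWork / BilateralWork census), the route is superseded / moot
with 1C.

NOT DECOMPOSED YET. DesignerExtension is not split: its normal form (24896 → CW) ∧ CatalystStability
is bookkeeping-equivalent, not finer, and cutting W′ by carrier class (Kolmogorov / Taylor-scale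
shelter / critical-layer catalyst) or by threshold exponent γ is deferred until T-SHRINK data or a
prover's obstruction says which. K and R are links to lens-3's items and are decomposed (or not) on
LoudWindows only; A is attacked on InviscidWork / 1C.

CHEAPEST FALSIFIER. Census T-SHRINK (cheap add-on to any designer-family run the cell already holds
— lens-5's Kolmogorov + Taylor-scale shelter, lens-1's critical-layer catalyst; informative only on
quiet-carrier designs): spin up under f + c at fixed ν to the loud state, set c ↦ θc, θ ∈ {1/2, 1/4,
1/8, 0}, same ν, same state; record the loud-state lifetime (cap 200 turnovers) and running means of
energy and injected f-power (w.r.t. the CARRIER f) over windows L ∈ {10, 30, 100} turnovers; repeat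
at two smaller ν. W′/D-world ⇒ windows of every L keep β(L) bounded below as θ → 0 (θ = 0 included)
with lifetimes growing with Re; W_crutch ⇒ floors and lifetimes collapse as θ ↓ 0. Not runnable by
this seat (kit_allowed false); REQUEST filed by lens-6 to decomp-ad-census-1 (INBOX
2026-08-30T07:41:25Z).

NUMBERS. T₁ constants (node card §3a): β = ε/32, bad-block energy threshold λ = (16FE′/ε)² with F =
‖f‖₂ + 1, E′ = E + 1, datum cap E₀ = 2λ(1+η)/η, δ₀ = ε/(32√(2λ)) — all depending on (E, ε, ‖f‖₂)
only, uniform in j, L, δ. T₂ output constants E_LLW = 2E_CW, β_LLW = β/2. Self-sustainment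
thresholds in shear flows: δ_c ∼ Re^(−γ), γ ≥ 1 ([corpus:arxiv-1403.6374 p.9]).

DEFINITION REQUESTS. None: CW CatalystWindows is spelled out inline inside CatalystStability over
Mathlib + Literature.Analysis.FluidPDE (IsGlobalLerayHopf, timeMean); the Leray–Hopf compactness
package wanted by T₂ is a Theorems-side debt (shared with 2B:26916 and the octave-ladder line), not
a Literature notion.

Novelty: Searches (lens-6 g8 2026-08-30 07:1x–07:3xZ, corpus fts+vec and galaxy, recorded in
DecoupledCatalysts_NODE.md §3/§4; writer re-checked the tree with `rg -n
"Decoupled|CatalystWindows|catalyst" lean/Summits/AnomalousDissipation lean/Literature` → only this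
node's names and the barrier file's tied families): `lit search --hybrid "weak solutions stable
under forcing perturbation fixed viscosity limit of Leray-Hopf solutions is Leray-Hopf"` →
[corpus:book-foias2001-navier-stokes-equations-turbulence p.333],
[corpus:paper-doi-10-3934-dcds-2007-17-481 p.6–7]; `lit galaxy search "Leray-Hopf|weak solution"
--star all` → substring noise; `lit search "designer forcing anomalous dissipation"`, `"vanishing
force perturbation anomalous dissipation"`, `"Cheskidov 1.3 converse"` (corpus + galaxy) → no
theorem of shape A″ → S or A″ → 24896-converse; self-sustainment: doi:10.1063/1.869185,
doi:10.1017/jfm.2017.97, [corpus:arxiv-1403.6374 p.9].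
Nearest prior art found: arXiv:2311.04182 Thm 1.3 (Cheskidov: tied designer families exist for SOME
forces — the barrier side); in the cell: 1C's own g3 split 26782/26783 (background change of
variables, EQUIV relabel + summit-class removal), InviscidWork/BilateralWork (conjunct A), lens-1's
/ DwellLadder's 30103 HorizonExtension (the same hinge 24058 reached from the TIME side; W′ reaches
it from the FORCE side — two distinct OR-branch residuals, neither implies the other in the tree),
lens-3's 24058/24059/24060 trunk (reused by name, not re-proved).  [refs: 10.1063/1.869185, 10.1017/jfm.2017.97, 2311.04182, book-foias2001-navier-stokes-equations-turbulence, paper-doi-10-3934-dcds-2007-17-481, doi:10.1063/1.869185, doi:10.1017/jfm.2017.97, arxiv-1403.6374]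

Barriers (technique_class: catalyst quantifier order; fixed-viscosity LH stability): - technique_class: catalyst quantifier order (tied ↦ decoupled) + fixed-viscosity Leray–Hopf weak
sequential stability in finite-window power currency
- Literature.Barriers.AnomalousDissipation.Cheskidov2023_thm13_not_forceRobustNoAnomaly
(ForceRobustEstimates.lean): W′ (and its normal form D_P) is OUTSIDE by construction — the barrier
quantifies over TIED families (`Tendsto (fun j => ⨆ t, eLpNorm (fs j t - f t) 2 volume) atTop (𝓝
0)`, one force per ν_j); W′'s consequent asks loud windows for the TRUE force (catalyst ZERO) at
every fixed ν_j and the normal form quantifies ∀ j ∀ δ, which no Thm-1.3 family satisfies (their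
level-j catalyst is pinned at ‖ν_jΔũ‖₂); the junction is not an estimate (critic: barrier placement
✓) [tree: Literature/Barriers/AnomalousDissipation/ForceRobustEstimates.lean].
- Quiet-root-floor / symmetric-family obstructions (tree file
Literature/Barriers/AnomalousDissipation/QuietRootFloorBarrier.lean, T0–T3, and the cell's symmetric
no-go lemmas): not in class — no steady or symmetric ansatz, data free.
- Onsager / convex-integration rigidity side (CET facts, not a barrier file): not in class —
Leray–Hopf runs only, no C^α Euler construction.
- T₂ CatalystStability / the junction glue (fixed-ν Leray–Hopf theory): no catalogued barrier
quantifies over fixed-ν statements; the Leray–Hopf energy-equality obstruction is AVOIDED by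
construction (power currency, energy inequality used only downward) — that obstruction is R = 24060,
declared once by lens-3; bc

sub-problem: AnomalousDissipation · status: draft · opened planner-decomp-ad-writer-1-g4-0 2026-08-30T08:00:52Z · rev 5 · ledger route-AnomalousDissipation-DecoupledCatalysts
GENERATED by the gate from the ledger (D-0016/17). Provers cite these decls: `theorem foo : Summit.AnomalousDissipation.AnomalousDissipation.Theses.DecoupledCatalysts.<Decl> := …` in Summits/AnomalousDissipation/AnomalousDissipation/Theorems/<Name>.lean.
-/

namespace Summit.AnomalousDissipation.AnomalousDissipation.Theses.DecoupledCatalysts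

open scoped BigOperators Topology Manifold Classical MeasureTheory ProbabilityTheory Matrix InnerProductSpace ComplexConjugate ContinuousMap
open Filter Set Function TopologicalSpace MeasureTheory

attribute [summit_statement] _root_.AnomalousDissipation

open Literature.Turb

/-- item stmt-AnomalousDissipation-30643 · crux · rank 2 · SPLIT (gen 1) into CatalystSmoothing, SmoothCatalystExtension + glue DesignerExtensionGlue · direct attempts still welcome (low priority) · by planner
why it might fail: W_crutch: designer anomalies may need catalysts at a FIXED positive L²-distance δ_j from f at each fixed ν_j (carrier laminar-attracting; shrinking catalysts δ(L,ν_j)→0 already give 24058 at j — lens-1 B4, crit 08:21:13Z); W_rough: tied anomalies only at non-smooth limit forces.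
sources: arXiv:2311.04182, doi:10.1063/1.869185, doi:10.1017/jfm.2017.97, arXiv:1403.6374, run/shared/lean/pub/decomp-ad/decomp-ad-lens-6/DecoupledCatalysts_NODE.md, run/shared/lean/pub/decomp-ad/decomp-ad-lens-1/W_CENSUS_g10.md
[crux] W′ · DESIGNER EXTENSION = the NEW DECLARED RESIDUAL of the designer axis (critic's
re-booking; text = (24896-text) → (24058-text), both tree texts verbatim): IF some L² force f is the
L²-limit of admissible steady forces fs j driving global Leray–Hopf runs at viscosities ν_j → 0 with
mean energy ≤ E and mean dissipation ≥ ε > 0 (a TIED steady designer anomaly), THEN for some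
ADMISSIBLE force f′ and some ν′_j → 0 there are E′, β > 0, T₀ such that at EVERY level j and for
EVERY T ≥ T₀ some datum and global Leray–Hopf run of NS(ν′_j, f′) have running means over [0, T]:
energy ≤ E′ and injected f′-power ≥ β (lens-3's 24058 LongLoudWindows). KERNEL-WEAKER than 24897
(24897 → W′ needs only S → 24058, proved in the node against tree decls); = 24897 modulo (A, K, R);
force-side twin of DwellLadder 30103. NORMAL FORM (critic): W′ ⟺ (24896 → CW CatalystWindows: loud
bounded windows of every length under admissible forces δ-close to f′, δ → 0 allowed to depend on
(L, ν_j)) modulo T₂ CatalystStability (support, filed after birth) and a T₁-type capping lemma.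
Failure worlds named in the docstring: W_crutch (every designer anomaly needs catalysts ≥ δ_c(ν_j) >
0: the carrier alone is lamin -/
@[route_item "route-AnomalousDissipation-DecoupledCatalysts", crux]
def DesignerExtension : Prop :=
  (∃ f : UnitAddTorus (Fin 3) → EuclideanSpace ℝ (Fin 3), MeasureTheory.MemLp f 2 MeasureTheory.volume ∧ ∃ (ν : ℕ → ℝ) (fs : ℕ → UnitAddTorus (Fin 3) → EuclideanSpace ℝ (Fin 3)) (u₀ : ℕ → UnitAddTorus (Fin 3) → EuclideanSpace ℝ (Fin 3)) (u : ℕ → ℝ → UnitAddTorus (Fin 3) → EuclideanSpace ℝ (Fin 3)), (∀ j, 0 < ν j) ∧ Tendsto ν atTop (𝓝 0) ∧ (∀ j, Literature.Analysis.FunctionSpaces.Torus.IsSmooth (fs j) ∧ Literature.Analysis.FunctionSpaces.Torus.IsDivFree (fs j) ∧ Literature.Analysis.FunctionSpaces.Torus.HasZeroMean (fs j)) ∧ Tendsto (fun j => MeasureTheory.eLpNorm (fs j - f) 2 MeasureTheory.volume) atTop (𝓝 0) ∧ (∀ j, Literature.Analysis.FluidPDE.Torus.IsGlobalLerayHopf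 (ν j) (fun _ => fs j) (u₀ j) (u j)) ∧ (∃ E : ℝ, ∀ j, Literature.Analysis.FluidPDE.meanEnergy (u j) ≤ E) ∧ ∃ ε : ℝ, 0 < ε ∧ ∀ j, ε ≤ Literature.Analysis.FluidPDE.meanDissipation (ν j) (u j)) → ∃ f : UnitAddTorus (Fin 3) → EuclideanSpace ℝ (Fin 3), Literature.Analysis.FunctionSpaces.Torus.IsSmooth f ∧ Literature.Analysis.FunctionSpaces.Torus.IsDivFree f ∧ Literature.Analysis.FunctionSpaces.Torus.HasZeroMean f ∧ ∃ ν : ℕ → ℝ, (∀ j, 0 < ν j) ∧ Filter.Tendsto ν Filter.atTop (nhds 0) ∧ ∃ E β : ℝ, 0 < β ∧ ∀ j : ℕ, ∀ T₀ : ℝ, ∃ T : ℝ, T₀ ≤ T ∧ ∃ (u₀ : UnitAddTorus (Fin 3) → EuclideanSpace ℝ (Fin 3)) (u : ℝ → UnitAddTorus (Fin 3) → EuclideanSpace ℝ (Fin 3)), Literature.Analysis.FluidPDE.Torus.IsGlobalLerayHopf (ν j) (fun _ => f) u₀ u ∧ Literature.Analysis.FluidPDE.timeMean (fun t => ∫ x,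 ‖u t x‖ ^ 2) T ≤ E ∧ β ≤ Literature.Analysis.FluidPDE.timeMean (fun t => ∫ x, inner ℝ (f x) (u t x)) T

-- parent: DesignerExtension · child (gen 1)
/--     item stmt-AnomalousDissipation-31800 · crux · rank 201 · open
    parent: DesignerExtension · by planner
    why it might fail: W_rough-only(H¹): H¹-small perturbations of a smooth steady force may be dynamically removable uniformly in ν (steady shadow of ForceRobustNoAnomalyNarrow TRUE), so every designer anomaly is sub-H¹: P1 false with 24896 true.
    sources: arXiv:2207.06301 Thm 1.1/1.2 p.4, §2 p.5, arXiv:2311.04182 Thm 1.3 p.5, p.18, arXiv:2409.03599 Thm 1.5 p.5, Literature.Barriers.AnomalousDissipation.ForceRobustEstimates (d), run/shared/lean/pub/decomp-ad/decomp-ad-lens-6/CatalystRegularity_NODE.md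
[crux · rank 3] CATALYST SMOOTHING: a steady designer anomaly with L²-tied catalysts (24896) can be
upgraded to one with an ADMISSIBLE smooth limit force and H¹-tied catalysts (A⁺). KERNEL-NECESSARY;
WEAKER than 30643 (K → R → W′ → P1; strict in world W_crutch(H¹)); IDEA-NEEDED (a DYNAMICAL designer
mechanism — every kinematic 2½-D cascade in print is class-capped below H¹: BDL 2023 Thm 1.2
'approaching the threshold C¹ on the Sobolev side we cannot show anomalous dissipation');
BARRIER-ADJACENT; INSTRUMENTABLE (planar class: velocity half closed by support PlanarCarrierQuiet,
scalar half = open crux 0211; a planar designer witness proves P1). Closes W′'s TYPE GAP (24896's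
limit force is MemLp-2 only and can never be 24058's admissible force). [decomp-ad lens-6 g9
CatalystRegularity; crit-1 g2 CLEARED 2026-08-30T09:37:59Z: KERNEL-NECESSARY · WEAKER(strict,
W_crutch(H¹)) · = A⁺ mod 24896 · IDEA-NEEDED · BARRIER-ADJACENT · INSTRUMENTABLE(T-PLANAR); node
HOME/decomp-ad-lens-6/CatalystRegularity.lean 1a8f8577…, card CatalystRegularity_NODE.md ec000164…] -/
@[route_item "route-AnomalousDissipation-DecoupledCatalysts"]
def CatalystSmoothing : Prop :=
  (∃ f : UnitAddTorus (Fin 3) → EuclideanSpace ℝ (Fin 3), MeasureTheory.MemLp f 2 MeasureTheory.volume ∧ ∃ (ν : ℕ → ℝ) (fs : ℕ → UnitAddTorus (Fin 3) → EuclideanSpace ℝ (Fin 3)) (u₀ : ℕ → UnitAddTorus (Fin 3) → EuclideanSpace ℝ (Fin 3)) (u : ℕ → ℝ → UnitAddTorus (Fin 3) → EuclideanSpace ℝ (Fin 3)), (∀ j, 0 < ν j) ∧ Tendsto ν atTop (𝓝 0) ∧ (∀ j, Literature.Analysis.FunctionSpaces.Torus.IsSmooth (fs j) ∧ Literature.Analysis.FunctionSpaces.Torus.IsDivFree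 (fs j) ∧ Literature.Analysis.FunctionSpaces.Torus.HasZeroMean (fs j)) ∧ Tendsto (fun j => MeasureTheory.eLpNorm (fs j - f) 2 MeasureTheory.volume) atTop (𝓝 0) ∧ (∀ j, Literature.Analysis.FluidPDE.Torus.IsGlobalLerayHopf (ν j) (fun _ => fs j) (u₀ j) (u j)) ∧ (∃ E : ℝ, ∀ j, Literature.Analysis.FluidPDE.meanEnergy (u j) ≤ E) ∧ ∃ ε : ℝ, 0 < ε ∧ ∀ j, ε ≤ Literature.Analysis.FluidPDE.meanDissipation (ν j) (u j)) → ∃ f : UnitAddTorus (Fin 3) → EuclideanSpace ℝ (Fin 3), Literature.Analysis.FunctionSpaces.Torus.IsSmooth f ∧ Literature.Analysis.FunctionSpaces.Torus.IsDivFree f ∧ Literature.Analysis.FunctionSpaces.Torus.HasZeroMean f ∧ ∃ (ν : ℕ → ℝ) (fs : ℕ → UnitAddTorus (Fin 3) → EuclideanSpace ℝ (Fin 3)) (u₀ : ℕ → UnitAddTorus (Fin 3) → EuclideanSpace ℝ (Fin 3)) (u : ℕ → ℝ → UnitAddTorus (Fin 3) → EuclideanSpace ℝ (Fin 3)), (∀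 j, 0 < ν j) ∧ Tendsto ν atTop (𝓝 0) ∧ (∀ j, Literature.Analysis.FunctionSpaces.Torus.IsSmooth (fs j) ∧ Literature.Analysis.FunctionSpaces.Torus.IsDivFree (fs j) ∧ Literature.Analysis.FunctionSpaces.Torus.HasZeroMean (fs j)) ∧ Tendsto (fun j => MeasureTheory.eLpNorm (fs j - f) 2 MeasureTheory.volume + ENNReal.ofReal (Literature.Analysis.FunctionSpaces.Torus.gradNormSq (fs j - f))) atTop (𝓝 0) ∧ (∀ j, Literature.Analysis.FluidPDE.Torus.IsGlobalLerayHopf (ν j) (fun _ => fs j) (u₀ j) (u j)) ∧ (∃ E : ℝ, ∀ j, Literature.Analysis.FluidPDE.meanEnergy (u j) ≤ E) ∧ ∃ ε : ℝ, 0 < ε ∧ ∀ j, ε ≤ Literature.Analysis.FluidPDE.meanDissipation (ν j) (u j)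

-- parent: DesignerExtension · child (gen 1)
/--     item stmt-AnomalousDissipation-31801 · crux · rank 202 · open
    parent: DesignerExtension · by planner
    why it might fail: W_crutch(H¹): even enstrophy-small smooth-limit catalysts may be indispensable at every level (the smooth carrier force relaminarises every bounded datum at fixed ν on long windows), so A⁺ holds and 24058 fails.
    sources: arXiv:2207.06301 Thm 1.1/1.2 p.4, arXiv:2311.04182 Thm 1.3, arXiv:2409.03599 Thm 1.5, Literature.Barriers.AnomalousDissipation.ForceRobustNoAnomalyNarrow, doi:10.1063/1.869185, doi:10.1017/jfm.2017.97
[crux · rank 2 · DECLARED RESIDUAL] SMOOTH-CATALYST EXTENSION: an H¹-tied steady designer anomaly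
around an ADMISSIBLE smooth force f (hinge A⁺ = 24896 with f smooth/div-free/mean-zero and eLpNorm
(fs j − f) 2 + ofReal (gradNormSq (fs j − f)) → 0) yields 24058 LongLoudWindows. KERNEL-NECESSARY;
WEAKER than 30643 (strict in world W_rough-only(H¹)); UNDECIDED(T-SHRINK at smooth carriers);
IDEA-NEEDED (fixed-ν continuation across the fixed positive H¹-distance δ_j — B4
CatalystShrinkCollapse applies inside: shrinking readings are the corner); BARRIER-FREE by
construction (hypothesis line (K1)+(K2) of
Literature.Barriers.AnomalousDissipation.ForceRobustNoAnomalyNarrow; outside Cheskidov Thm 1.3 / BDL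
/ JS classes). NOT CLAIMED easier by mechanism than 30643 (free-stirrer caveat: an H¹-small catalyst
still commands an O(1) stirrer at mesoscale (ν/δ)^{1/3}). [decomp-ad lens-6 g9 CatalystRegularity;
crit-1 g2 CLEARED 2026-08-30T09:37:59Z: NEW DECLARED RESIDUAL of the designer lineage (24897 ← 30643
← this) · KERNEL-NECESSARY · WEAKER(strict, W_rough-only(H¹)) · UNDECIDED(T-SHRINK at smooth
carriers) · IDEA-NEEDED · BARRIER-FREE by construction; priced LOW–MODERATE (exact trim W′ ⟺ P1 ∧ P2 -/
@[route_item "route-AnomalousDissipation-DecoupledCatalysts"]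
def SmoothCatalystExtension : Prop :=
  (∃ f : UnitAddTorus (Fin 3) → EuclideanSpace ℝ (Fin 3), Literature.Analysis.FunctionSpaces.Torus.IsSmooth f ∧ Literature.Analysis.FunctionSpaces.Torus.IsDivFree f ∧ Literature.Analysis.FunctionSpaces.Torus.HasZeroMean f ∧ ∃ (ν : ℕ → ℝ) (fs : ℕ → UnitAddTorus (Fin 3) → EuclideanSpace ℝ (Fin 3)) (u₀ : ℕ → UnitAddTorus (Fin 3) → EuclideanSpace ℝ (Fin 3)) (u : ℕ → ℝ → UnitAddTorus (Fin 3) → EuclideanSpace ℝ (Fin 3)), (∀ j, 0 < ν j) ∧ Tendsto ν atTop (𝓝 0) ∧ (∀ j, Literature.Analysis.FunctionSpaces.Torus.IsSmooth (fs j) ∧ Literature.Analysis.FunctionSpaces.Torus.IsDivFree (fs j) ∧ Literature.Analysis.FunctionSpaces.Torus.HasZeroMean (fs j)) ∧ Tendsto (fun j => MeasureTheory.eLpNorm (fs j - f) 2 MeasureTheory.volume + ENNReal.ofReal (Literature.Analysis.FunctionSpaces.Torus.gradNormSq (fs j - f))) atTop (𝓝 0) ∧ (∀ j, Literature.Analysis.FluidPDE.Torus.IsGlobalLerayHopf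 (ν j) (fun _ => fs j) (u₀ j) (u j)) ∧ (∃ E : ℝ, ∀ j, Literature.Analysis.FluidPDE.meanEnergy (u j) ≤ E) ∧ ∃ ε : ℝ, 0 < ε ∧ ∀ j, ε ≤ Literature.Analysis.FluidPDE.meanDissipation (ν j) (u j)) → ∃ f : UnitAddTorus (Fin 3) → EuclideanSpace ℝ (Fin 3), Literature.Analysis.FunctionSpaces.Torus.IsSmooth f ∧ Literature.Analysis.FunctionSpaces.Torus.IsDivFree f ∧ Literature.Analysis.FunctionSpaces.Torus.HasZeroMean f ∧ ∃ ν : ℕ → ℝ, (∀ j, 0 < ν j) ∧ Filter.Tendsto ν Filter.atTop (nhds 0) ∧ ∃ E β : ℝ, 0 < β ∧ ∀ j : ℕ, ∀ T₀ : ℝ, ∃ T : ℝ, T₀ ≤ T ∧ ∃ (u₀ : UnitAddTorus (Fin 3) → EuclideanSpace ℝ (Fin 3)) (u : ℝ → UnitAddTorus (Fin 3) → EuclideanSpace ℝ (Fin 3)), Literature.Analysis.FluidPDE.Torus.IsGlobalLerayHopf (ν j) (fun _ => f) u₀ u ∧ Literature.Analysis.FluidPDE.timeMean (fun t => ∫ x,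 ‖u t x‖ ^ 2) T ≤ E ∧ β ≤ Literature.Analysis.FluidPDE.timeMean (fun t => ∫ x, inner ℝ (f x) (u t x)) T

-- parent: DesignerExtension · glue (gen 1)
/--     item stmt-AnomalousDissipation-31802 · support · rank 203 · closed · proved by Summit.AnomalousDissipation.AnomalousDissipation.Theorems.DesignerExtensionGlue.designerExtensionGlue_holds (prover)
    parent: DesignerExtension · GLUE: children ⟹ parent · by planner
CatalystSmoothing → SmoothCatalystExtension → DesignerExtension (provable now: fun h₁ h₂ hA => h₂
(h₁ hA) = node splitGlue_holds / writer SketchCR designerExtensionGlueW_holds) -/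
@[route_item "route-AnomalousDissipation-DecoupledCatalysts"]
def DesignerExtensionGlue : Prop :=
  CatalystSmoothing → SmoothCatalystExtension → DesignerExtension

-- `DesignerExtensionGlue` holds: proved by `Summit.AnomalousDissipation.AnomalousDissipation.Theorems.DesignerExtensionGlue.designerExtensionGlue_holds` (its module imports this route file, so no `_holds` link can be stated here).

/-- item stmt-AnomalousDissipation-24896 · crux · rank 3 · open · by planner
why it might fail: Conjunct A of the root split: a designer family needs a mechanism holding dissipation up as ν ↓ 0 at bounded energy with steady admissible forces; every candidate (junction cascade, frozen lift, bilateral selection) is open and the rigid/symmetric classes are excluded by the cell's no-go lemmas.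
sources: arXiv:2311.04182, DoeringFoias2002, arXiv:2409.03599, arXiv:1902.08084
[crux] [crux, the conjunct attacked; TAG WEAKER-formal with KERNEL necessity (lens
`steadyDesignerAnomaly_of_summit`, f_j := f; critic CLEARED 01:42:42Z: «genuine NEW RUNG «Cheskidov
1.3 with time-independent forces / BDL Q2.2 long-time», not known ⟹ S, not barrier-excluded ✓;
degenerate audit ✓ + critic's addition: an L²-only limit force cannot trivialise A — an L² tail
injects ≤ δ√E power, so ≥ ε−δ must enter through finitely many low modes at bounded energy and be
cascaded; linear/shear designer families die (low mode of f ≠ 0 ⇒ energy ~ ν⁻²; f = 0 ⇒ power →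
0)»); LEAVES: OR-branch leaf FrozenCarrierScalarAnomaly (lens file l.387; planar frozen carriers v_j
sustained by steady designer forces F_j → F in L²(𝕋²), steady smooth source h, scalar
mean-dissipation floor with bounded scalar energy) tagged by the critic OPEN LEMMA with machinery in
hand (steady-source / resolvent analogue of arXiv:2409.03599 Thm 1.1/1.5), UNDECIDED(test: ν-uniform
resolvent bound ‖(v_ν·∇ − νΔ)⁻¹‖ on σ(H)^⊥ for a truncated JS-type field), weakly INSTRUMENTABLE;
FrozenLift (leaf → A) routine support via the PROVED TwoAndHalfD lift; BC5 rung by name BELOW A: the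
printed periodic rung = tree fact Literature -/
@[route_item "route-AnomalousDissipation-DecoupledCatalysts", crux]
def SteadyDesignerAnomaly : Prop :=
  ∃ f : UnitAddTorus (Fin 3) → EuclideanSpace ℝ (Fin 3), MeasureTheory.MemLp f 2 MeasureTheory.volume ∧ ∃ (ν : ℕ → ℝ) (fs : ℕ → UnitAddTorus (Fin 3) → EuclideanSpace ℝ (Fin 3)) (u₀ : ℕ → UnitAddTorus (Fin 3) → EuclideanSpace ℝ (Fin 3)) (u : ℕ → ℝ → UnitAddTorus (Fin 3) → EuclideanSpace ℝ (Fin 3)), (∀ j, 0 < ν j) ∧ Tendsto ν atTop (𝓝 0) ∧ (∀ j, Literature.Analysis.FunctionSpaces.Torus.IsSmooth (fs j) ∧ Literature.Analysis.FunctionSpaces.Torus.IsDivFree (fs j) ∧ Literature.Analysis.FunctionSpaces.Torus.HasZeroMean (fs j)) ∧ Tendsto (fun j => MeasureTheory.eLpNorm (fs j - f) 2 MeasureTheory.volume) atTop (𝓝 0) ∧ (∀ j, Literature.Analysis.FluidPDE.Torus.IsGlobalLerayHopf (ν j) (fun _ => fs j) (u₀ j) (u j)) ∧ (∃ E : ℝ,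 ∀ j, Literature.Analysis.FluidPDE.meanEnergy (u j) ≤ E) ∧ ∃ ε : ℝ, 0 < ε ∧ ∀ j, ε ≤ Literature.Analysis.FluidPDE.meanDissipation (ν j) (u j)

/-- item stmt-AnomalousDissipation-30104 · support · rank 9 · open · by planner
why it might fail: It is lens-3's theorem-grade compactness step (long loud windows ⇒ a power-floor family); risk = size of the Leray–Hopf window-compactness formalisation, not truth.
sources: run/shared/lean/pub/decomp-ad/decomp-ad-lens-3/LoudWindows_NODE.md, Temam1977, FMRTTurbulence2001
[support · CROSS-LINK BY NAME := LoudWindows.WindowCompactness = item 24059 (THEOREM-GRADE L,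
ATTACKABLE NOW — staffed on route LoudWindows, NOT here; closes by `id` the moment 24059 is proved).
Why by name and not «shared by signature»: LoudWindows files 24059 as `LongLoudWindows →
PowerFloorFamily` over its own decls, so an inlined copy would NOT merge under the signature
normaliser (cf. StrainDichotomy 29900 vs 2A 25780) and would be staffed twice; the alias makes the
identity kernel-literal (chk_K := Iff.rfl); lens-1 g8 NODE HorizonJunction
(HOME/decomp-ad-lens-1/HorizonJunction.lean sha256 e211a135…, lean rc0 · 0 sorry; card
HorizonJunction_NODE.md 6038f228…; probes HorizonJunction_bc7.out.txt 6/6 CLEAN; crit-1 CLEARED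
2026-08-30T07:01:59Z; writer paste check g4/HJ/SketchHJ.lean rc0: chk_W/chk_K/chk_T/chk_SF :=
Iff.rfl, glue, closes)] WINDOW COMPACTNESS (K): long loud bounded windows at each fixed ν ⟹ a
power-floor family (LoudWindows 24058 → 24057). -/
@[route_item "route-AnomalousDissipation-DecoupledCatalysts", crux]
def WindowCompactnessLink : Prop :=
  Summit.AnomalousDissipation.AnomalousDissipation.Theses.LoudWindows.WindowCompactness

/-- item stmt-AnomalousDissipation-30105 · support · rank 9 · open · by planner
why it might fail: The Leray–Hopf energy-equality obstruction (W_defect: power injected need not be dissipated along a weak solution); it is the cell's one declared toll, placed by lens-3, residual of LoudWindows.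
sources: run/shared/lean/pub/decomp-ad/decomp-ad-lens-3/LoudWindows_NODE.md, DuchonRobert2000, arXiv:1710.05205
[support · CROSS-LINK BY NAME := LoudWindows.PowerRealisesDissipation = item 24060 (lens-3's
DECLARED TOLL of LoudWindows, not re-split here; staffed/accounted on LoudWindows; closes by `id`
when 24060 does); same by-name rationale as WindowCompactnessLink (chk_T := Iff.rfl); lens-1 g8 NODE
HorizonJunction (HOME/decomp-ad-lens-1/HorizonJunction.lean sha256 e211a135…, lean rc0 · 0 sorry;
card HorizonJunction_NODE.md 6038f228…; probes HorizonJunction_bc7.out.txt 6/6 CLEAN; crit-1 CLEARED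
2026-08-30T07:01:59Z; writer paste check g4/HJ/SketchHJ.lean rc0: chk_W/chk_K/chk_T/chk_SF :=
Iff.rfl, glue, closes)] POWER REALISES DISSIPATION (T): a power-floor family ⟹ the zeroth law
(LoudWindows 24057 → S). -/
@[route_item "route-AnomalousDissipation-DecoupledCatalysts", crux]
def PowerRealisesDissipationLink : Prop :=
  Summit.AnomalousDissipation.AnomalousDissipation.Theses.LoudWindows.PowerRealisesDissipation

/-- item stmt-AnomalousDissipation-30665 · support · rank 9 · open · by planner
why it might fail: Only through the formalisation debt (no Aubin–Lions / limit-of-Leray–Hopf-runs package in the tree yet); mathematically the fixed-ν existence compactness scheme (Temam III.3.1, FMRT p.333, CTV07 Prop. 2).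
sources: Temam1977, FMRTTurbulence2001, doi:10.3934/dcds.2007.17.481, RobinsonRodrigoSadowski2016, run/shared/lean/pub/decomp-ad/decomp-ad-lens-6/DecoupledCatalysts_NODE.md
[support · T₂ · THEOREM-GRADE L · ATTACKABLE NOW · CLEARED TRUE by decomp-ad-crit-1 g2 07:48:49Z ·
antecedent = the node's CW CatalystWindows text inlined] CATALYST STABILITY: if one admissible f,
ν_j → 0, a datum cap E₀, a bound E and a floor β > 0 admit for every j, every window length L > 0
and every δ > 0 an admissible steady g with ‖g − f‖₂ ≤ δ, a datum with ∫‖u₀‖² ≤ E₀ and a global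
Leray–Hopf run of NS(ν_j, g) with running means over [0, L] energy ≤ E and f-power ≥ β (decoupled
catalyst windows), THEN lens-3's 24058 LongLoudWindows holds (windows for the TRUE force at every
fixed ν_j). Proof plan (node card §3b, critic re-derived): g_n → f in L², capped data ⇒ uniform L∞L²
∩ L²H¹ on [0, L′] (energy inequality + Grönwall), Aubin–Lions on 𝕋³, limit solves NS(ν_j, f) weakly,
a.e.-two-time energy inequality by strong convergence + lsc, RESTART at t* ∈ (0, ηL) of strong
convergence so the limit is IsGlobalLerayHopf from u(t*); window constants E_LLW = 2E, β_LLW = β/2.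
This is the ⇐ half of the critic's normal form W′ ⟺ (24896 → CW); the Leray–Hopf compactness package
is the formalisation debt shared with 2B:26916 / the octave-ladder line. Kernel-necessary (S →
24058). -/
@[route_item "route-AnomalousDissipation-DecoupledCatalysts"]
def CatalystStability : Prop :=
  (∃ f : UnitAddTorus (Fin 3) → EuclideanSpace ℝ (Fin 3), Literature.Analysis.FunctionSpaces.Torus.IsSmooth f ∧ Literature.Analysis.FunctionSpaces.Torus.IsDivFree f ∧ Literature.Analysis.FunctionSpaces.Torus.HasZeroMean f ∧ ∃ ν : ℕ → ℝ, (∀ j, 0 < ν j) ∧ Filter.Tendsto ν Filter.atTop (nhds 0) ∧ ∃ E₀ E β : ℝ, 0 < β ∧ ∀ j : ℕ, ∀ L : ℝ, 0 < L → ∀ δ : ℝ, 0 < δ → ∃ g : UnitAddTorus (Fin 3) → EuclideanSpace ℝ (Fin 3), (Literature.Analysis.FunctionSpaces.Torus.IsSmooth g ∧ Literature.Analysis.FunctionSpaces.Torus.IsDivFree g ∧ Literature.Analysis.FunctionSpaces.Torus.HasZeroMean g) ∧ MeasureTheory.eLpNorm (g - f) 2 MeasureTheory.volume ≤ ENNReal.ofReal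 δ ∧ ∃ (u₀ : UnitAddTorus (Fin 3) → EuclideanSpace ℝ (Fin 3)) (u : ℝ → UnitAddTorus (Fin 3) → EuclideanSpace ℝ (Fin 3)), ∫ x, ‖u₀ x‖ ^ 2 ≤ E₀ ∧ Literature.Analysis.FluidPDE.Torus.IsGlobalLerayHopf (ν j) (fun _ => g) u₀ u ∧ Literature.Analysis.FluidPDE.timeMean (fun t => ∫ x, ‖u t x‖ ^ 2) L ≤ E ∧ β ≤ Literature.Analysis.FluidPDE.timeMean (fun t => ∫ x, inner ℝ (f x) (u t x)) L) → Summit.AnomalousDissipation.AnomalousDissipation.Theses.LoudWindows.LongLoudWindows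

/-- item stmt-AnomalousDissipation-30666 · support · rank 9 · open · by planner
sources: run/shared/lean/pub/decomp-ad/decomp-ad-lens-6/DecoupledCatalysts.lean
[support · JUNCTION GLUE · PROVABLE NOW (writer sketch designerTransferJunctionGlue_holds := fun hW
hK hR hA => LoudWindows.closes (hW hA) hK hR; node designerTransfer_of_junction)] records that this
child route REFINES 1C:24897 DesignerTransfer: W′ DesignerExtension → K WindowCompactnessLink → R
PowerRealisesDissipationLink → RootDecompCycle1C.DesignerTransfer (by name). Bookkeeping only;
closes does not use it. -/
@[route_item "route-AnomalousDissipation-DecoupledCatalysts"]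
def DesignerTransferJunctionGlue : Prop :=
  DesignerExtension → WindowCompactnessLink → PowerRealisesDissipationLink → Summit.AnomalousDissipation.AnomalousDissipation.Theses.RootDecompCycle1C.DesignerTransfer

/-- item stmt-AnomalousDissipation-30667 · aside · rank 9 · open · by planner
sources: run/shared/lean/pub/decomp-ad/decomp-ad-lens-6/DecoupledCatalysts.lean, arXiv:2311.04182, doi:10.1063/1.869185
[aside · NORMAL FORM D_P of the residual W′ DesignerExtension («normal form ≡ W′ mod bookkeeping»,
lens-6 v2 §2 / critic 07:48:49Z; NOT separately counted, never staffed) · text = (24896-text) → (CW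
CatalystWindows text)] DESIGNER CATALYST WINDOWS: a tied steady designer anomaly yields DECOUPLED
catalyst windows — at every fixed ν_j, for every window length L and every δ > 0, a δ-close
admissible steady force with a capped-datum global Leray–Hopf run that is loud (f-power ≥ β) and
bounded (energy ≤ E) on [0, L]. Kernel (node, 0 sorry): D_P ∧ CatalystStability ⟹ W′
(designerExtension_of_normalForm) and W′ ∧ WindowCapping ⟹ D_P (WindowCapping := 24058 → CW,
THM-GRADE M, not filed). OUTSIDE ForceRobustNoAnomalyAt (tied families) by its ∀ j ∀ δ quantifier. -/
@[route_item "route-AnomalousDissipation-DecoupledCatalysts"]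
def DesignerCatalystWindows : Prop :=
  (∃ f : UnitAddTorus (Fin 3) → EuclideanSpace ℝ (Fin 3), MeasureTheory.MemLp f 2 MeasureTheory.volume ∧ ∃ (ν : ℕ → ℝ) (fs : ℕ → UnitAddTorus (Fin 3) → EuclideanSpace ℝ (Fin 3)) (u₀ : ℕ → UnitAddTorus (Fin 3) → EuclideanSpace ℝ (Fin 3)) (u : ℕ → ℝ → UnitAddTorus (Fin 3) → EuclideanSpace ℝ (Fin 3)), (∀ j, 0 < ν j) ∧ Tendsto ν atTop (𝓝 0) ∧ (∀ j, Literature.Analysis.FunctionSpaces.Torus.IsSmooth (fs j) ∧ Literature.Analysis.FunctionSpaces.Torus.IsDivFree (fs j) ∧ Literature.Analysis.FunctionSpaces.Torus.HasZeroMean (fs j)) ∧ Tendsto (fun j => MeasureTheory.eLpNorm (fs j - f) 2 MeasureTheory.volume) atTop (𝓝 0) ∧ (∀ j, Literature.Analysis.FluidPDE.Torus.IsGlobalLerayHopf (ν j) (fun _ => fs j) (u₀ j) (u j)) ∧ (∃ E : ℝ, ∀ j, Literature.Analysis.FluidPDE.meanEnergy (u j) ≤ E) ∧ ∃ ε : ℝ,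 0 < ε ∧ ∀ j, ε ≤ Literature.Analysis.FluidPDE.meanDissipation (ν j) (u j)) → ∃ f : UnitAddTorus (Fin 3) → EuclideanSpace ℝ (Fin 3), Literature.Analysis.FunctionSpaces.Torus.IsSmooth f ∧ Literature.Analysis.FunctionSpaces.Torus.IsDivFree f ∧ Literature.Analysis.FunctionSpaces.Torus.HasZeroMean f ∧ ∃ ν : ℕ → ℝ, (∀ j, 0 < ν j) ∧ Filter.Tendsto ν Filter.atTop (nhds 0) ∧ ∃ E₀ E β : ℝ, 0 < β ∧ ∀ j : ℕ, ∀ L : ℝ, 0 < L → ∀ δ : ℝ, 0 < δ → ∃ g : UnitAddTorus (Fin 3) → EuclideanSpace ℝ (Fin 3), (Literature.Analysis.FunctionSpaces.Torus.IsSmooth g ∧ Literature.Analysis.FunctionSpaces.Torus.IsDivFree g ∧ Literature.Analysis.FunctionSpaces.Torus.HasZeroMean g) ∧ MeasureTheory.eLpNorm (g - f) 2 MeasureTheory.volume ≤ ENNReal.ofReal δ ∧ ∃ (u₀ : UnitAddTorus (Fin 3) → EuclideanSpace ℝ (Fin 3)) (u : ℝ → UnitAddTorus (Fin 3) → EuclideanSpace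 ℝ (Fin 3)), ∫ x, ‖u₀ x‖ ^ 2 ≤ E₀ ∧ Literature.Analysis.FluidPDE.Torus.IsGlobalLerayHopf (ν j) (fun _ => g) u₀ u ∧ Literature.Analysis.FluidPDE.timeMean (fun t => ∫ x, ‖u t x‖ ^ 2) L ≤ E ∧ β ≤ Literature.Analysis.FluidPDE.timeMean (fun t => ∫ x, inner ℝ (f x) (u t x)) L

/-- item stmt-AnomalousDissipation-31806 · support · rank 9 · open · by planner
why it might fail: Theorem-grade (2-D enstrophy balance + interpolation, limsup-safe); risk = formalisation size of the 2-D Leray–Hopf enstrophy pairing with L² data (restart trick of meanDissipation_sq_le_of_L2), not truth.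
sources: AlexakisDoering2006PLA §2, DoeringFoias2002 §2, Literature.Barriers.AnomalousDissipation.TwoDimensionalEnergyDissipationL2Data, run/shared/lean/pub/decomp-ad/decomp-ad-lens-6/CatalystRegularity_NODE.md
[support · THEOREM-GRADE M · ATTACKABLE NOW] PLANAR CARRIER QUIET: a 2-D global Leray–Hopf flow on
𝕋² under a steady smooth mean-zero force g with gradNormSq g ≤ G and meanEnergy ≤ E has
meanDissipation ≤ (ν E² G)^{1/3}. Proof: 2-D enstrophy balance pairing ∇g with ∇u (ν⟨‖Δu‖²⟩ ≤
G^{1/2}(ε/ν)^{1/2}) + interpolation ⟨‖∇u‖²⟩² ≤ ⟨‖u‖²⟩⟨‖Δu‖²⟩ ⇒ ε^{3/2} ≤ ν^{1/2} E G^{1/2}; template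
Literature.Barriers.AnomalousDissipation.TwoDimensionalEnergyDissipationL2Data.meanDissipation_sq_le_of_L2
(pairs Δg with u). Use: in the x₃-invariant class an A⁺-witness must carry the whole anomaly in the
passive third component; VOID for L²-tied catalysts — the H¹ threshold in one line. [decomp-ad
lens-6 g9; crit-1 g2 CLEARED 09:37:59Z (iv): THM-GRADE M, constant checked; prover target] -/
@[route_item "route-AnomalousDissipation-DecoupledCatalysts"]
def PlanarCarrierQuiet : Prop :=
  ∀ (ν : ℝ) (g : UnitAddTorus (Fin 2) → EuclideanSpace ℝ (Fin 2)) (u₀ : UnitAddTorus (Fin 2) → EuclideanSpace ℝ (Fin 2)) (u : ℝ → UnitAddTorus (Fin 2) → EuclideanSpace ℝ (Fin 2)) (G E : ℝ), 0 < ν → Literature.Analysis.FunctionSpaces.Torus.IsSmooth g → Literature.Analysis.FunctionSpaces.Torus.HasZeroMean g → Literature.Analysis.FunctionSpaces.Torus.gradNormSq g ≤ G → Literature.Analysis.FluidPDE.Torus.IsGlobalLerayHopf ν (fun _ => g) u₀ u → Literature.Analysis.FluidPDE.meanEnergy u ≤ E → Literature.Analysis.FluidPDE.meanDissipation ν u ≤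 (ν * (E ^ 2 * G)) ^ ((1 : ℝ) / 3)

/-- item stmt-AnomalousDissipation-30644 · assembly · rank 1 · open · by planner
sources: run/shared/lean/pub/decomp-ad/decomp-ad-lens-6/DecoupledCatalysts.lean
[assembly] SteadyDesignerAnomaly → DesignerExtension → WindowCompactnessLink →
PowerRealisesDissipationLink → AnomalousDissipation — four binders, every one consumed: `closes hA
hW hK hR := LoudWindows.closes (hW hA) hK hR` (equivalently `RootDecompCycle1C.closes hA
(designerTransferJunctionGlue_holds hW hK hR)`; writer sketch, both forms rc 0). -/
@[route_item "route-AnomalousDissipation-DecoupledCatalysts"]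
def Assembly : Prop :=
  SteadyDesignerAnomaly → DesignerExtension → WindowCompactnessLink → PowerRealisesDissipationLink → _root_.AnomalousDissipation

/-! D-0027 §2.1 — DECIDING THEOREM (planner-authored via `route open/edit --closes-file`; by planner-decomp-ad-writer-1-g4-0 2026-08-30T08:00:52Z):
its hypotheses are this route's items and its conclusion the sub-problem Statement (glue_lint), and it elaborates with this file. -/

@[closes "route-AnomalousDissipation-DecoupledCatalysts"] theorem closes (hA : SteadyDesignerAnomaly) (hW : DesignerExtension) (hK : WindowCompactnessLink)
    (hR : PowerRealisesDissipationLink) : _root_.AnomalousDissipation :=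
  Summit.AnomalousDissipation.AnomalousDissipation.Theses.LoudWindows.closes (hW hA) hK hR

end Summit.AnomalousDissipation.AnomalousDissipation.Theses.DecoupledCatalysts
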